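import Literature.IUT.HodgeArakelov.TemperedThetaMonoids
import Literature.IUT.HodgeArakelov.GaloisPairRigidity

/-!
# [IUTchII] §3, Propositions 3.1, 3.3, 3.4 — sub-DAG statements (W6-S6 of SUBDAG-WANTED (L6) v1):
# the OPEN junctions of `plan/L6/SUBDAG-IUTchII-Prop-31-33-34.md` as typed `Prop`s over landed declarations

S. Mochizuki, *Inter-universal Teichmüller theory II*, §3 "Tempered Gaussian Frobenioids" (kurims Dec-2020
manuscript), Proposition 3.1 (i)(ii) pp. 87–88, Proposition 3.3 (i)(ii) pp. 89–90, Proposition 3.4 (i)(ii)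
pp. 91–93 [cite: Mochizuki2012, Prop 3.1 p.87]. Claim key DISPUTED (D-0012): STATEMENTS ONLY (`Prop`-valued
definitions over the declarations of abc-iut-L6-t2's `TemperedThetaMonoids.lean` p404874 and abc-iut-L6-t1's
`AbsTopInterfaces.lean` / `GaloisPairRigidity.lean`); nothing here is asserted, no named fact is added, and nothing
takes a side on [IUTchIII] Cor. 3.12.  abc-iut cell, D-0068 (1) "decompose recursively, statements-first",
seat abc-iut-w5-d169; the row ids J2, J4, J6, J7, J9, J13 are those of the sub-DAG file.

All three printed proofs read «Assertions (i) and (ii) follow immediately from the definitions and the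
references quoted in the statements of these assertions» (p. 88 l. 25–26, p. 90 l. 77–78, p. 93 l. 6–7), so the
junctions are the INPUT CLAUSES the quoted references deliver.  The typed statement of record keeps the Kummer
isomorphisms of Prop. 3.3 as DATA (`Prop33KummerStatements`, with a `Prop`-valued slot `equivariance`) and the
radiality assertions of Prop. 3.4 as SLOTS (`RadialityStatements`); this file gives the LAWS print attaches to
them a checkable form:

* `ThetaEnvData.ThetaEnvPermuted` (J2) — Prop. 3.1 (i) p. 87 l. 47–53 «ι ranges over the inversion
  automorphisms of Proposition 2.2, (i) …; this collection of subsets is equipped with a natural conjugation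
  action by Π_X(M^Θ_*)»: the conjugation action permutes the INPUT subsets `θ^ι_env`, `∞θ^ι_env` (the hypothesis
  `hperm` of abc-iut-L6-d3's `ThetaEnvData.conj_permutes_of_thetaEnv` / `prop31Statements_of_val`, p405901);
* `ThetaEnvData.KummerInput` (J4) — Prop. 3.1 (ii) p. 88 l. 2–24 «By applying the cyclotomic rigidity
  isomorphisms of Corollaries 2.8, (i); 2.9 … Ψ_cns(M^Θ_*) := M_TM(M^Θ_*) ⊆ lim_J H¹(…) … naturally isomorphic to
  O^▷_{F̄_v} [cf. Example 1.8, (ii)] — equipped with a natural conjugation action»: the three properties of the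
  Kummer map `κ : M_TM(Π_X(M^Θ_*)) → lim_J H¹` used by `TemperedThetaMonoidsProofs2.lean` (p411791/p411800) —
  injective, `Π_X`-equivariant, `Ψ_cns = image` — as ONE `Prop` over the [AbsTopIII] interface `AbsTopMonoids`
  (plan/GAP-LEDGER.md G-w4d019-1; BUILT at the model by `AbsoluteAnabelian/MonoidKummerEquivariantModel.lean`);
* `Prop33KummerStatements.IsKummerInduced` (J6) — Prop. 3.3 (i)(ii) p. 90 l. 28–33, 62–67 «By forming Kummer classes
  relative to the Frobenioid structure of †F_v»: the isomorphisms of the datum are RESTRICTIONS of one monoid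
  homomorphism `k : O^×(T^÷_{A^Θ_∞}) → lim_J H¹` (proved inhabited under generator-level hypotheses:
  `exists_prop33KummerStatements_of_kummer`, `TemperedThetaMonoidsProofs4.lean`);
* `Prop33KummerStatements.LabelFactorsThrough` (J7) — Prop. 3.3 (i) p. 90 l. 34–36 «for a suitable bijection of
  l·ℤ-torsors between [Gal(Ÿ_v/Y_v)-orbits of] “ι” … and images of “α” via the natural surjection Π_v ↠ l·ℤ»: the
  label assignment `α ↦ ι(α)` depends only on the image of `α` in `l·ℤ` (factorisation half; the torsor half needs
  the `Gal(Ÿ_v/Y_v)`-orbit structure on the index set, not carried by the record — left to abc-iut-L6-t1);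
* `Prop33KummerStatements.IsEquivariant` (J9) — Prop. 3.3 (i)(ii) p. 90 «compatible with … the respective
  conjugation actions by Π_X(M^Θ_*)», as an elementwise law on the isomorphisms of the datum (replaces the
  `Prop`-slot `equivariance` by a checkable statement);
* `Prop34iiUniradialContent` (J13) — Prop. 3.4 (ii) pp. 92–93 «fails to be compatible … with automorphisms of the
  pair G_v ↷ (Ψ_{†C_v})^{×μ} which arise from automorphisms of the pair G_v ↷ (Ψ_{†C_v})^× [cf. Remarks 1.11.1, (i),
  (b); 1.8.1] — in the sense that this algorithm, as given, only admits a uniradial formulation»: over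
  abc-iut-L6-t1's `AbsTopMonoids`/`PairAut`, some `G`-equivariant automorphism of `O^{×μ}(G)` is induced by an
  automorphism of the pair `G ↷ O^×(G)` over `1 ∈ Aut(G)` and by NO automorphism of the TM-pair `G ↷ O^⊳(G)` over
  `1` (proved from the named facts `Rmk1111_a/_b`: `prop34ii_uniradialContent_of_rmk1111`,
  `TemperedThetaMonoidsProofs4.lean`).

Not typed here (recorded in the sub-DAG file): J1/J5/J10 (producer → record data BRIDGES, abc-iut-L6-t1 /
abc-iut-L5-t2 merge touches), J3 (= the field `Prop31Statements.splitting` itself; its input is a divisor map,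
data), J8/J14 (proved, `TemperedThetaMonoidsProofs4.lean`), J11 (`unitsModTorsionOf`, abc-iut-L6-t2, DEFINED),
J12 (Prop. 3.4 (i) multiradiality = abc-iut-L6-t1's SHAPE THEOREM `cor111_multiradiallyDefined`, cited, not restated).
-/

namespace Literature.IUT.HodgeArakelov

namespace TemperedThetaMonoids

open CategoryTheory

universe u v

/-! ### J2 — Prop 3.1 (i): the conjugation action permutes the input subsets `θ^ι_env`, `∞θ^ι_env` -/

/-- **J2** ([IUTchII] Prop. 3.1 (i) p. 87 l. 47–53 «ι ranges over the inversion automorphisms of Proposition 2.2,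
(i) …; this collection of subsets is equipped with a natural conjugation action by `Π_X(M^Θ_*)`»): every
`g ∈ Π_X(M^Θ_*)` carries each INPUT subset `θ^ι_env`, `∞θ^ι_env` onto the subsets attached to some inversion
automorphism `ι'` (conjugates of inversion automorphisms are inversion automorphisms, Prop. 2.2 (i)).  This is
the hypothesis `hperm` of `ThetaEnvData.conj_permutes_of_thetaEnv` (p405901), under which the field
`Prop31Statements.conj_permutes` is PROVED; at the model it is delivered by the `Π`-functoriality of the
cohomology (`CohomologyAutFunctoriality.autMap_image_orbit`). Statement only. [cite: Mochizuki2012, Prop 3.1 (i) p.87] -/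
def ThetaEnvData.ThetaEnvPermuted {P : Type u} [Group P] (E : ThetaEnvData.{u, v} P) : Prop :=
  ∀ (g : P) (ι : E.Iota), ∃ ι' : E.Iota,
    E.conj g '' E.thetaEnv ι = E.thetaEnv ι' ∧ E.conj g '' E.inftyThetaEnv ι = E.inftyThetaEnv ι'

/-! ### J4 — Prop 3.1 (ii): the Kummer map of the constant monoid (GAP-LEDGER G-w4d019-1 as one `Prop`) -/

/-- **J4** ([IUTchII] Prop. 3.1 (ii) p. 88 l. 2–24 «By applying the cyclotomic rigidity isomorphisms of Corollaries
2.8, (i); 2.9 … one obtains a functorial algorithm `M^Θ_* ↦ Ψ_cns(M^Θ_*) := M_TM(M^Θ_*) ⊆ lim_J H¹(Π_Ÿ(M^Θ_*)|_J,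
Π_μ(M^Θ_*))` … naturally isomorphic to `O^▷_{F̄_v}` [cf. Example 1.8, (ii)] — equipped with a natural conjugation
action by `Π_X(M^Θ_*)`»): for the Example 1.8 (ii) output `M_TM(Π)` at the isomorph `Π = Π_X(M^Θ_*)` (abc-iut-L6-t1
`AbsTopMonoids.MTM`, `actMTM`) and the Prop. 3.1 record `E` over `Π_X(M^Θ_*)`, there is a monoid homomorphism
`κ : M_TM(Π_X(M^Θ_*)) → lim_J H¹` — the Kummer map of [AbsTopIII] Prop. 3.2 (ii) composed with the cyclotomic
rigidity isomorphism of the ambient module — which is INJECTIVE (Kummer theory of MLF's), `Π_X(M^Θ_*)`-EQUIVARIANT,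
and whose image IS `Ψ_cns(M^Θ_*)` (the printed definition `Ψ_cns := M_TM`).  Exactly the hypotheses
`hκ`/`hκeq`/`hcns` of `TemperedThetaMonoidsProofs2.lean` (p411791/p411800), i.e. plan/GAP-LEDGER.md row G-w4d019-1,
bundled; BUILT at the [AbsTopIII] Def. 3.1 (i) model by `ModelMLFGaloisData.constantsKummerHom`
(`MonoidKummerEquivariantModel.lean`). Statement only. [cite: Mochizuki2012, Prop 3.1 (ii) p.88] -/
def ThetaEnvData.KummerInput {S : ThetaSetting.{u}} (A : AbsTopMonoids S) (Pc : IsoClass S.PiX)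
    (E : ThetaEnvData.{u, v} Pc.G) : Prop :=
  ∃ κ : A.MTM Pc →* E.H,
    Function.Injective κ ∧
      (∀ (x : Pc.G) (m : A.MTM Pc), κ (A.actMTM Pc x m) = E.conj x (κ m)) ∧
        E.constantMonoid = MonoidHom.mrange κ

/-! ### J6, J7, J9 — Prop 3.3: laws on the Kummer-isomorphism datum -/

namespace Prop33KummerStatements

variable {P : Type u} [Group P] {E : ThetaEnvData.{u, v} P} {F : TemperedFrobenioidThetaData.{u, v} P}

/-- **J6** ([IUTchII] Prop. 3.3 (i)(ii) p. 90 «By forming Kummer classes relative to the Frobenioid structure of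
`†F_v` — i.e., in essence, by considering the Galois cohomology classes that arise when one extracts `N`-th roots …
[cf. [FrdII], Definition 2.1, (ii); [IUTchI], Remark 3.2.3, (ii); the discussion of [EtTh], §5]»): the datum `K` is
INDUCED by the monoid homomorphism `k : O^×(T^÷_{A^Θ_∞}) → lim_J H¹(Π_Ÿ(M^Θ_*)|_J, Π_μ(M^Θ_*))` (the Kummer map of
the tempered Frobenioid, valued in the ambient module through the exterior cyclotome of Prop. 1.3 (i)) — every
isomorphism `Ψ_{†F^Θ_v,α} ⥲ Ψ^ι_env`, `∞Ψ_{†F^Θ_v,α} ⥲ ∞Ψ^ι_env`, `Ψ_{†C_v} ⥲ Ψ_cns` of `K` is `k` on elements.  («well-defined up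
to composition with an inner automorphism» = the freedom `k ↦ conj γ ∘ k`, `γ ∈ Π_X(M^Θ_*)`, in the choice of `k`.)
Inhabited under generator-level hypotheses: `exists_prop33KummerStatements_of_kummer`
(`TemperedThetaMonoidsProofs4.lean`). Statement only. [cite: Mochizuki2012, Prop 3.3 p.90] -/
def IsKummerInduced (K : Prop33KummerStatements E F) (k : F.K →* E.H) : Prop :=
  (∀ (α : P) (x : F.frobThetaMonoid α), ((K.kummerTheta α x).1 : E.H) = k x) ∧
    (∀ (α : P) (x : F.inftyFrobThetaMonoid α), ((K.kummerInftyTheta α x).1 : E.H) = k x) ∧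
      ∀ x : F.baseMonoid, ((K.kummerConstant x).1 : E.H) = k x

/-- **J7** ([IUTchII] Prop. 3.3 (i) p. 90 l. 34–36 «for a suitable bijection of `l·ℤ`-torsors between
[`Gal(Ÿ_v/Y_v)`-orbits of] “`ι`” as in Proposition 2.2, (i), and images of “`α`” via the natural surjection
`Π_v ↠ l·ℤ`»), FACTORISATION HALF: the label assignment `α ↦ ι(α)` of the datum depends only on the image of `α`
under the surjection `Π_v ↠ l·ℤ` (typed over an abstract homomorphism `toLZ` onto the additive group `ℤ` written
multiplicatively; at the model, abc-iut-L2-t8's `DoubleUnderline.toLZ`).  The TORSOR half («bijection of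
`l·ℤ`-torsors» with the `Gal(Ÿ_v/Y_v)`-orbits of inversion automorphisms) needs the orbit structure on the index
set `Iota`, which the Prop. 3.1 record does not carry (owner abc-iut-L6-t1, Prop. 2.2 (i)); not typed here.
Statement only. [cite: Mochizuki2012, Prop 3.3 (i) p.90] -/
def LabelFactorsThrough (K : Prop33KummerStatements E F) (toLZ : P →* Multiplicative ℤ) : Prop :=
  Function.Surjective toLZ ∧ ∀ α β : P, toLZ α = toLZ β → K.label α = K.label β

/-- **J9** ([IUTchII] Prop. 3.3 (i)(ii) p. 90 «compatible with both the respective conjugation actions by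
`Π_X(M^Θ_*)` …»), as an elementwise LAW on the datum (a checkable successor of the `Prop`-slot `equivariance`):
for `β ∈ Π_X(M^Θ_*)`, whenever `β` carries an element `x ∈ Ψ_{†F^Θ_v,α}` into `Ψ_{†F^Θ_v,βα}` (resp. `∞Ψ`, resp. stabilises
`Ψ_{†C_v}`), the isomorphism at `βα` (resp. the constant isomorphism) of `β·x` is `β` applied to the isomorphism at
`α` of `x`.  For a Kummer-induced datum (J6) this is exactly the `Π_X(M^Θ_*)`-equivariance of `k`. Statement only.
[cite: Mochizuki2012, Prop 3.3 p.90] -/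
def IsEquivariant (K : Prop33KummerStatements E F) : Prop :=
  (∀ (β α : P) (x : F.frobThetaMonoid α) (hx : F.conj β x.1 ∈ F.frobThetaMonoid (β * α)),
      ((K.kummerTheta (β * α) ⟨F.conj β x.1, hx⟩).1 : E.H) = E.conj β ((K.kummerTheta α x).1 : E.H)) ∧
    (∀ (β α : P) (x : F.inftyFrobThetaMonoid α) (hx : F.conj β x.1 ∈ F.inftyFrobThetaMonoid (β * α)),
      ((K.kummerInftyTheta (β * α) ⟨F.conj β x.1, hx⟩).1 : E.H) =
        E.conj β ((K.kummerInftyTheta α x).1 : E.H)) ∧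
      ∀ (β : P) (x : F.baseMonoid) (hx : F.conj β x.1 ∈ F.baseMonoid),
        ((K.kummerConstant ⟨F.conj β x.1, hx⟩).1 : E.H) = E.conj β ((K.kummerConstant x).1 : E.H)

end Prop33KummerStatements

/-! ### J13 — Prop 3.4 (ii): the checkable content of "uniradiality of constant monoids" -/

/-- **J13** ([IUTchII] Prop. 3.4 (ii) pp. 92–93 «the functorial algorithm `Π_v ↦ Ψ_cns(M^Θ_*(Π_v))` … depends on
the cyclotomic rigidity isomorphism of Corollary 1.11, (b) …, hence fails to be compatible … with automorphisms
of […] the pair `G_v(M^Θ_*(†F_v)) ↷ (Ψ_{†C_v})^{×μ}` which arise from automorphisms of […] the pair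
`G_v(M^Θ_*(†F_v)) ↷ (Ψ_{†C_v})^×` [cf. Remarks 1.11.1, (i), (b); 1.8.1] — in the sense that this algorithm, as given,
only admits a uniradial formulation»), CHECKABLE CONTENT over abc-iut-L6-t1's [AbsTopIII] interface (Example 1.8:
`O^⊳(G)`, `O^×(G) ↠ O^{×μ}(G)`, the `G`-actions; Remark 1.11.1 (i): `PairAut`): there is an automorphism `ψ` of
`O^{×μ}(G)` commuting with the `G`-action (an automorphism of the coric pair `G ↷ O^{×μ}(G)` over `1 ∈ Aut(G)`) which
IS induced by an automorphism of the pair `G ↷ O^×(G)` over `1` and is induced by NO automorphism of the TM-pair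
`G ↷ O^⊳(G)` over `1` — so no algorithm whose output is rigidified through `O^⊳(G)` (the constant monoid with its
Kummer/valuation structure, Cor. 1.11 (b)) is compatible with it.  PROVED from the named facts `Rmk1111_a/_b`
(+ one non-trivially acting `u ∈ Ẑ^×`): `prop34ii_uniradialContent_of_rmk1111` (`TemperedThetaMonoidsProofs4.lean`).
Statement only. [cite: Mochizuki2012, Prop 3.4 (ii) p.92] -/
def Prop34iiUniradialContent {S : ThetaSetting.{u}} (A : AbsTopMonoids S) (G : IsoClass S.Gk) : Prop :=
  ∃ ψ : MulAut (A.Oxmu G),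
    (∀ (g : G.G) (x : A.Oxmu G), ψ (A.actOxmu G g x) = A.actOxmu G g (ψ x)) ∧
      (∃ p : PairAut G (A.Ounits G) (A.actOunits G), PairAut.forget p = 1 ∧
          ∀ x : A.Ounits G, (QuotientGroup.mk (p.1.2 x) : A.Oxmu G) = ψ (QuotientGroup.mk x)) ∧
        ∀ q : PairAut G (A.Otri G) (A.actOtri G), PairAut.forget q = 1 →
          ∃ x : A.Ounits G,
            (QuotientGroup.mk (Units.map q.1.2.toMonoidHom x) : A.Oxmu G) ≠ ψ (QuotientGroup.mk x)

end TemperedThetaMonoids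

end Literature.IUT.HodgeArakelov
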